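import Literature.NumberTheory.EllipticCurves.KuriharaNumberKimCertificate
import Literature.NumberTheory.EllipticCurves.PAdicBSD
import Literature.NumberTheory.EllipticCurves.BSDSelmerPConverseSerreProofs
import Literature.NumberTheory.EllipticCurves.NonEisensteinPrimeOfSurjective
import HarnessLib

/-!
# Kim's mod-`p` rank certificate: the printed architecture, as a proved reduction

`Proofs` companion (theorems only: no definition, no new named fact) of
`Literature.NumberTheory.EllipticCurves.KuriharaNumberKimCertificate` for the named fact
`Literature.NumberTheory.EllipticCurves.Kim2022_kuriharaNumber_certificate` (C.-H. Kim,
arXiv:2203.12159 = Amer. J. Math., Thm. 1.11 with its `Ш[p] = 0` clause, at a good ordinary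
prime `p ≥ 5` with `ρ̄_{E,p}` onto, where statement (3) of that theorem is itself a theorem).

## The printed proof, and what this file proves

The fact is **not** discharged here (literature-prover triage: size XL). As printed it is the
composite of exactly two published theorems, of two different papers, and this file PROVES the
composition, with both theorems stated inline — in the tree's vocabulary and binder for binder —
as the hypotheses `hKim` and `hMC` of
`Kim2022_kuriharaNumber_certificate_of_rankFormula_of_mainConjecture`:

* **(A) Kim 2022, Thm. 1.11, (3) ⟹ (1) with the mod-`p` rank formula** (PDF p. 8; proof §6,
  PDF p. 31: Büyükboduk's `Λ`-adic rigidity Thm. 6.1, Cor. 6.3, "the Iwasawa main conjecture is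
  equivalent to `f ∈ Λˣ`", Mazur–Rubin's core ranks Thm. 2.4 and
  `dim_𝔽_p Sel₀(ℚ, E[p]) = ord(κ^{Kato,(1)})`, and the Chebotarev choice of a useful Kolyvagin
  prime, Prop. 2.3). "Let `E/ℚ` and `p ≥ 5` be such that
  (i) `ρ̄` is surjective, (ii) the Manin constant is prime to `p`, (iii) `E(ℚ_p)[p] = 0`, (iv) all
  Tamagawa factors are prime to `p`. Then the following statements are equivalent. (1) `δ̃⁽¹⁾_n ≠ 0`
  in `𝔽_p` for some `n ∈ 𝒩₁` with `ν(n) = ord(δ̃⁽¹⁾)`. (2) … (3) The Iwasawa main conjecture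
  [Conj. 1.3 = Kato's main conjecture without `p`-adic `L`-functions,
  `char_Λ(H¹_Iw(ℚ, T)/Λκ₁^{Kato,∞}) = char_Λ(Sel₀(ℚ_∞, E[p^∞])^∨)` in `Λ`] holds. … If we
  further assume that `Ш(E/ℚ)[p]` is trivial, then `rk_ℤ E(ℚ) = ord(δ̃⁽¹⁾) = ν(n)`." At a good
  ORDINARY `p` (the only case the tree can phrase: `unitRoot`, `padicLFunction`) statement (3) is,
  prime of height one by prime of height one, Mazur–Greenberg's main conjecture
  `X(E/ℚ_∞)` torsion and `char_Λ X(E/ℚ_∞) = (L_p(E))` in `Λ` for the Néron-normalised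
  `L_p(E) = L_{p-adic,α,ω,γ}` with good `ω, γ` (Kato 2004, Conj. 17.6, p. 274): Kato, Astérisque
  295, §17.13, p. 280, displays for EVERY height-one prime `𝔭` of `Λ` (for `𝔭 ∋ p` under
  `p ≠ 2` and (12.5.2), "the image of `Gal(ℚ̄/ℚ(ζ_{p^∞}))` contains `SL₂(ℤ_p)`", which holds when
  `ρ_{E,p}` is onto) the identity `length(X_𝔭) − length(Λ_𝔭/(L_{p-adic})) = length(H²(T)_𝔭) −
  length(H¹(T)_𝔭/Z(f,T)_𝔭)`, "Hence Thm. 17.4 (resp. Conj. 17.6) becomes a consequence of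
  Thm. 12.5 (resp. Conj. 12.10)" — and conversely, the identity being an equality of differences;
  this is the passage Kim himself makes in the proof of Cor. 1.5 (p. 6: "Since the Iwasawa main
  conjecture inverting `p` for elliptic curves with good ordinary reduction at `p` is established
  under our setting [Kato, Skinner–Urban, Wan] …", the cited theorems being in Mazur's form).
  (At a good ordinary NON-anomalous `p` the implication (3) ⟹ (1) with `dim_𝔽_p Sel(ℚ, E[p]) =
  ν(d)` is also R. Sakamoto, *`p`-Selmer group and modular symbols*, Doc. Math. 27 (2022) =
  arXiv:2106.03370, Cor. 4.3 with Thm. 1.5, whose "Iwasawa main conjecture for `E/ℚ`" is printed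
  in exactly this Mazur form, `ξ̃_{ℚ_∞} Λ = char_Λ(Sel(ℚ_∞, E[p^∞])^∨)` (§3.5, p. 13), `ξ̃`
  normalised by the Néron period `Ω⁺_E` (§1); Kim, p. 8: "Theorem 1.11 recovers the main result of
  [Sakamoto]".) In the tree's normalisation: under the period transfer `Ω(W) = u · Ω⁺_f` of the
  parent statement, the Néron-normalised `p`-adic `L`-function is `u⁻¹ · padicLFunction f α`
  (`L_p(E/ℚ) = ϖ · padicLFunction f α`, `ϖ · Ω_E = Ω⁺_f`, module docstring of `PAdicBSD`,
  Normalisations), so (3) reads: for every model `(κ, γ, S)` of `(ℚ_∞, γ, X(E/ℚ_∞))`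
  (`κ.IsCyclotomic`, `κ.IsTopGenerator γ`, `IsCyclotomicVariable p γ`, `S : W.SelmerDualData κ γ`
  — the binders of `kato_divisibility` and `burungale_castella_skinner_charIdeal_eq_padicLFunction`),
  `S.X` is torsion and `S.charIdeal = (g)` with `ι g = C(u⁻¹) · padicLFunction D.f α`.
  This is hypothesis `hKim`; proposed name for the named fact: `Kim2022_kuriharaNumber_rankFormula_of_mainConjecture`.
* **(B) Burungale–Castella–Skinner 2025, Thm. 1.1.2 (b)** (IMRN 2025 rnaf082 = arXiv:2405.00270v2,
  p. 2): "Let `E` be an elliptic curve defined over `ℚ` and `p` a prime of good ordinary reduction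
  for `E`. (a) If `p > 3` satisfies (irr_ℚ), then `X^ord(E/ℚ_∞)` is `Λ`-torsion, with
  `ch_Λ(X^ord(E/ℚ_∞)) = (L_p(E/ℚ))` in `Λ ⊗ ℚ_p`. (b) If in addition there exists an element
  `σ ∈ G_{ℚ(μ_{p^∞})}` such that `T/(σ − 1)T ≃ ℤ_p` (im), then the equality holds in `Λ`", with
  `L_p(E/ℚ)` "the `p`-adic `L`-function attached to `E` by Mazur–Swinnerton-Dyer" (p. 1), Néron-
  normalised; proof p. 10 ((5.3) from Wan's divisibility by base change, (5.4) = Kato Thm. 17.4 "in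
  `Λ` if hypothesis (im) holds", "a proper divisibility in (5.4) would contradict (5.3)"). Part (a)
  is the tree's named fact `burungale_castella_skinner_charIdeal_eq_padicLFunction`; part (b) is its
  `TODO(general form)`. The tree has no vocabulary for (im) (no `p`-adic Tate module); it is
  replaced by the STRONGER, tree-expressible "`ρ̄_{E,p^m}` onto for every `m`" (i.e. `ρ_{E,p}` onto
  `GL₂(ℤ_p)`, the integral clause 3 of `kato_divisibility`), which gives (im) with
  `ρ(σ) = (1 1; 0 1) ∈ SL₂(ℤ_p) = ρ(G_{ℚ(μ_{p^∞})})`. This is hypothesis `hMC` (special case;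
  proposed name `burungale_castella_skinner_charIdeal_eq_padicLFunction_integral`).
  -- TODO(general form): (im) itself, and weight-two newforms (§5 of the source).

The GLUE proved here is the rest of the printed argument: `ρ̄_{E,p}` onto and `p ≥ 5` give
`ρ̄_{E,p^m}` onto for all `m` (Serre 1968, IV §3.4 — the tree THEOREM
`serre_hasSurjectiveModNGaloisRep_pow_holds`) and `E[p]` irreducible (the tree theorem
`hasIrreducibleModPGaloisRep_of_hasSurjectiveModNGaloisRep`); good ordinary is
`IsOrdinaryAt = hgood ∧ hord`; the newform is `D.f` (`D.isNewformOf`); the period witness `u` is a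
`p`-adic unit, in particular `u ≠ 0`. A second assembly,
`Kim2022_kuriharaNumber_certificate_of_rankFormula_of_mainConjecture'`, takes (B) with the
generator normalised by the tree's `Ω⁺_f` instead (`ι g = padicLFunction f α`, the shape of
clause 3 of `kato_divisibility`): the two normalisations define the same ideal of `Λ` because `u` is
a `p`-adic unit (`exists_span_eq_and_map_eq_C_inv_mul_iff`, proved: rescale the generator by the
unit constant `C(u) ∈ Λˣ`).

Not here: any `def`; the two hypotheses are NOT vendored as named facts by this file (D-0026); the
Kolyvagin-system content of (A) (Mazur–Rubin, Büyükboduk, Kato's Euler system and explicit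
reciprocity law) and the automorphic content of (B) are not in Mathlib or the tree.

## References

* [Kim2022StructureSelmer] C.-H. Kim, arXiv:2203.12159 (Amer. J. Math.): Thm. 1.11 (PDF p. 8),
  Conj. 1.3 (§1.2.4, p. 5), Cor. 1.5–1.6 (p. 6), §6 (p. 31).
* [Kato2004Asterisque] K. Kato, Astérisque 295 (2004): Conj. 12.10, Thm. 17.4 (p. 273), Conj. 17.6
  (p. 274), §17.13 (pp. 279–280).
* [BurungaleCastellaSkinner2025] A. Burungale, F. Castella, C. Skinner, IMRN 2025 rnaf082 =
  arXiv:2405.00270v2: Thm. 1.1.2 and Remark 1.1.3 (p. 2), proof of Thm. 1.1.2 (p. 10).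
* [Sakamoto2022pSelmer] R. Sakamoto, *`p`-Selmer group and modular symbols*, Doc. Math. 27
  (2022) = arXiv:2106.03370: Thm. 1.2, Thm. 1.5 (p. 3), §3.5 and Prop. 3.16 (p. 13), Cor. 4.3
  (p. 14).
* [SerreAbelianLadic1968] J.-P. Serre, *Abelian `ℓ`-adic representations* (1968), IV §3.4.
-/

noncomputable section

open scoped MatrixGroups ModularForm Classical

open CongruenceSubgroup WeierstrassCurve Literature.NumberTheory.EllipticCurves.ModularForms

namespace Literature.NumberTheory.EllipticCurves

/-! ### Néron period versus `Ω⁺_f`: rescaling a generator by a `p`-adic unit -/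

section Rescale

variable (p : ℕ) [Fact p.Prime]

/-- **The two normalisations of the main-conjecture identity agree.** If `u ∈ ℚ` is a `p`-adic
unit then, for an ideal `I` of `Λ = ℤ_p⟦T⟧` and any `L ∈ ℚ_p⟦T⟧`, "`I = (g)` with
`ι g = u⁻¹ · L`" and "`I = (g)` with `ι g = L`" are equivalent: rescale the generator by the unit
constant power series `C(u) ∈ Λˣ` (resp. `C(u)⁻¹`). With `I = char_Λ X(E/ℚ_∞)`,
`L = padicLFunction f α` and `Ω(W) = u · Ω⁺_f` this is the passage between the Néron-normalised
`L_p(E/ℚ) = u⁻¹ · L` of Mazur–Swinnerton-Dyer / Kato (good `ω`) / Burungale–Castella–Skinner and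
the tree's `Ω⁺_f`-normalised `L` (module docstring of `PAdicBSD`, Normalisations). [folklore] -/
theorem exists_span_eq_and_map_eq_C_inv_mul_iff {u : ℚ} (hu : ‖(u : ℚ_[p])‖ = 1)
    (I : Ideal (IwasawaAlgebra p)) (L : PowerSeries ℚ_[p]) :
    (∃ g : IwasawaAlgebra p, I = Ideal.span {g} ∧
        iwasawaToPowerSeries p g = PowerSeries.C ((u : ℚ_[p])⁻¹) * L) ↔
      ∃ g : IwasawaAlgebra p, I = Ideal.span {g} ∧ iwasawaToPowerSeries p g = L := by
  have hu0 : (u : ℚ_[p]) ≠ 0 := fun h => by simp [h] at hu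
  -- the `p`-adic unit `c = u ∈ ℤ_pˣ`
  set c : ℤ_[p] := ⟨(u : ℚ_[p]), hu.le⟩
  have hcu : (c : ℚ_[p]) = (u : ℚ_[p]) := rfl
  have hc1 : ‖c‖ = 1 := by rw [PadicInt.norm_def, hcu, hu]
  obtain ⟨v, hv⟩ := PadicInt.isUnit_iff.mpr hc1
  have hvq : ((v : ℤ_[p]) : ℚ_[p]) = (u : ℚ_[p]) := by rw [hv, hcu]
  have hvinvq : ((↑v⁻¹ : ℤ_[p]) : ℚ_[p]) = (u : ℚ_[p])⁻¹ := by
    have h1 : ((↑v⁻¹ : ℤ_[p]) : ℚ_[p]) * (u : ℚ_[p]) = 1 := by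
      rw [← hvq, ← PadicInt.coe_mul, Units.inv_mul, PadicInt.coe_one]
    exact eq_inv_of_mul_eq_one_left h1
  have hCv : IsUnit (PowerSeries.C (v : ℤ_[p]) : IwasawaAlgebra p) :=
    (Units.isUnit v).map PowerSeries.C
  have hCvinv : IsUnit (PowerSeries.C (↑v⁻¹ : ℤ_[p]) : IwasawaAlgebra p) :=
    (Units.isUnit v⁻¹).map PowerSeries.C
  have hmapC : ∀ a : ℤ_[p], iwasawaToPowerSeries p (PowerSeries.C a) =
      PowerSeries.C ((a : ℤ_[p]) : ℚ_[p]) := fun a => by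
    simp [iwasawaToPowerSeries, PowerSeries.map_C]
  constructor
  · rintro ⟨g, hI, hg⟩
    refine ⟨PowerSeries.C (v : ℤ_[p]) * g, ?_, ?_⟩
    · rw [hI, Ideal.span_singleton_mul_left_unit hCv]
    · rw [map_mul, hmapC, hg, hvq, ← mul_assoc, ← map_mul, mul_inv_cancel₀ hu0, map_one, one_mul]
  · rintro ⟨g, hI, hg⟩
    refine ⟨PowerSeries.C (↑v⁻¹ : ℤ_[p]) * g, ?_, ?_⟩
    · rw [hI, Ideal.span_singleton_mul_left_unit hCvinv]
    · rw [map_mul, hmapC, hg, hvinvq]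

end Rescale

/-! ### The certificate from Kim's Theorem 1.11 and the main conjecture in `Λ` -/

/-- **Kim's mod-`p` rank certificate from its two printed ingredients.** If
(A, `hKim`) Kim 2022, Thm. 1.11 [(3) ⟹ (1) and the rank formula under `Ш[p] = 0`] holds at good
ordinary primes, with its statement (3) read — by Kato 2004, §17.13 (p. 280) — as the
Mazur–Greenberg main conjecture in `Λ` for the Néron-normalised `p`-adic `L`-function
`u⁻¹ · padicLFunction D.f α` (`Ω(W) = u · Ω⁺_f`), for every model `(κ, γ, S)` of
`X(E/ℚ_∞)`; and (B, `hMC`) Burungale–Castella–Skinner 2025, Thm. 1.1.2 (b) holds in the special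
case "`ρ̄_{E,p^m}` onto for all `m`" of its hypothesis (im) (equality
`char_Λ X(E/ℚ_∞) = (L_p(E/ℚ))` in `Λ`, `L_p(E/ℚ)` Néron-normalised, at a good ordinary `p ≥ 5`
with `E[p]` irreducible); then `Kim2022_kuriharaNumber_certificate` holds. The proof is the
remaining printed glue: Serre (`ρ̄_{E,p}` onto, `p ≥ 5` ⟹ every `ρ̄_{E,p^m}` onto:
`serre_hasSurjectiveModNGaloisRep_pow_holds`), onto ⟹ irreducible
(`hasIrreducibleModPGaloisRep_of_hasSurjectiveModNGaloisRep`), `IsOrdinaryAt = good ∧ ordinary`,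
the newform `D.f` of the parametrisation datum, and `u ≠ 0` for a `p`-adic unit `u`.
[cite: Kim2022StructureSelmer, Thm. 1.11 (PDF p. 8) and §6 (p. 31); Kato2004Asterisque, §17.13 (p. 280); BurungaleCastellaSkinner2025, Thm. 1.1.2 (b) (p. 2 of arXiv:2405.00270v2)] -/
theorem Kim2022_kuriharaNumber_certificate_of_rankFormula_of_mainConjecture
    (hKim : ∀ (W : WeierstrassCurve ℚ) [W.IsElliptic] [W.IsGloballyMinimal] (p : ℕ) [Fact p.Prime],
      5 ≤ p → IsOrdinaryAt W p → W.HasSurjectiveModNGaloisRep p →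
      (∀ P : (W.baseChange ℚ_[p]).toAffine.Point, (p : ℤ) • P = 0 → P = 0) →
      ¬ p ∣ W.tamagawaProduct →
      (∀ x : W.sha, (p : ℤ) • x = 0 → x = 0) →
      ∀ {N : ℕ} [NeZero N] (D : ModularParametrizationData W N),
      ¬ (p : ℤ) ∣ D.maninConstant →
      ∀ u : ℚ, ‖(u : ℚ_[p])‖ = 1 → W.realPeriodRat = u * plusPeriod D.f →
      (∀ (κ : ZpExtension ℚ p) (γ : Field.absoluteGaloisGroup ℚ), κ.IsCyclotomic →
        κ.IsTopGenerator γ → IsCyclotomicVariable p γ → ∀ S : W.SelmerDualData κ γ,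
        S.IsTorsion ∧ ∃ g : IwasawaAlgebra p, S.charIdeal = Ideal.span {g} ∧
          iwasawaToPowerSeries p g =
            PowerSeries.C ((u : ℚ_[p])⁻¹) * padicLFunction D.f (unitRoot W p : ℚ_[p])) →
      ∃ (n : ℕ) (_ : NeZero n), Squarefree n ∧ n.primeFactors.card = W.mordellWeilRank ∧
        (∀ ℓ ∈ n.primeFactors, ¬ ℓ ∣ N * p ∧ (ℓ : ZMod p) = 1 ∧
          (W.frobeniusTrace ℓ : ZMod p) = 2) ∧
        ∃ ψ : (ℓ : ℕ) → (ZMod ℓ)ˣ →* Multiplicative (ZMod p),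
          (∀ ℓ ∈ n.primeFactors, Function.Surjective (ψ ℓ)) ∧ kuriharaNumber D.f p n ψ ≠ 0)
    (hMC : ∀ (W : WeierstrassCurve ℚ) [W.IsElliptic] [W.IsGloballyMinimal] (p : ℕ) [Fact p.Prime]
      (κ : ZpExtension ℚ p) (γ : Field.absoluteGaloisGroup ℚ) {N : ℕ} [NeZero N]
      (f : CuspForm (Gamma0 N) 2) (u : ℚ),
      5 ≤ p → W.HasGoodReductionAtPrime p → ¬ (p : ℤ) ∣ W.frobeniusTrace p →
      W.HasIrreducibleModPGaloisRep p → (∀ m : ℕ, W.HasSurjectiveModNGaloisRep (p ^ m : ℕ)) →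
      κ.IsCyclotomic → κ.IsTopGenerator γ → IsCyclotomicVariable p γ → IsNewformOf W f →
      u ≠ 0 → W.realPeriodRat = u * plusPeriod f →
      ∀ S : W.SelmerDualData κ γ, S.IsTorsion ∧ ∃ g : IwasawaAlgebra p,
        S.charIdeal = Ideal.span {g} ∧
          iwasawaToPowerSeries p g =
            PowerSeries.C ((u : ℚ_[p])⁻¹) * padicLFunction f (unitRoot W p : ℚ_[p])) :
    Kim2022_kuriharaNumber_certificate := by
  intro W _ _ p _ h5 hord hsurj htors htam hsha N _ D hc hper
  obtain ⟨u, hu1, hu⟩ := hper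
  have hu0 : u ≠ 0 := by
    rintro rfl
    simp at hu1
  have hgood : W.HasGoodReductionAtPrime p := ((isOrdinaryAt_iff W p).1 hord).1
  have hap : ¬ (p : ℤ) ∣ W.frobeniusTrace p := ((isOrdinaryAt_iff W p).1 hord).2
  have hirr : W.HasIrreducibleModPGaloisRep p :=
    hasIrreducibleModPGaloisRep_of_hasSurjectiveModNGaloisRep W p hsurj
  have him : ∀ m : ℕ, W.HasSurjectiveModNGaloisRep (p ^ m : ℕ) :=
    serre_hasSurjectiveModNGaloisRep_pow_holds W p h5 hsurj
  exact hKim W p h5 hord hsurj htors htam hsha D hc u hu1 hu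
    (fun κ γ hκ hγ hγ' S =>
      hMC W p κ γ D.f u h5 hgood hap hirr him hκ hγ hγ' D.isNewformOf hu0 hu S)

/-- **The same assembly with (B) in the tree's `Ω⁺_f`-normalisation** (`ι g = padicLFunction f α`,
the shape of the integral clause 3 of `kato_divisibility`): under the period transfer with a
`p`-adic unit `u` the two normalisations of the main-conjecture identity coincide
(`exists_span_eq_and_map_eq_C_inv_mul_iff`), so Kim's certificate also follows from (A) and the
`Ω⁺_f`-normalised equality `char_Λ X(E/ℚ_∞) = (padicLFunction f α)` in `Λ` at good ordinary
`p ≥ 5` with `ρ̄_{E,p^m}` onto for all `m` and `Ω(W) = u · Ω⁺_f`, `|u|_p = 1`.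
[cite: Kim2022StructureSelmer, Thm. 1.11 (PDF p. 8); BurungaleCastellaSkinner2025, Thm. 1.1.2 (b) (p. 2 of arXiv:2405.00270v2); Kato2004Asterisque, Thm. 17.4 (3) (p. 273) and §17.13 (p. 280)] -/
theorem Kim2022_kuriharaNumber_certificate_of_rankFormula_of_mainConjecture'
    (hKim : ∀ (W : WeierstrassCurve ℚ) [W.IsElliptic] [W.IsGloballyMinimal] (p : ℕ) [Fact p.Prime],
      5 ≤ p → IsOrdinaryAt W p → W.HasSurjectiveModNGaloisRep p →
      (∀ P : (W.baseChange ℚ_[p]).toAffine.Point, (p : ℤ) • P = 0 → P = 0) →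
      ¬ p ∣ W.tamagawaProduct →
      (∀ x : W.sha, (p : ℤ) • x = 0 → x = 0) →
      ∀ {N : ℕ} [NeZero N] (D : ModularParametrizationData W N),
      ¬ (p : ℤ) ∣ D.maninConstant →
      ∀ u : ℚ, ‖(u : ℚ_[p])‖ = 1 → W.realPeriodRat = u * plusPeriod D.f →
      (∀ (κ : ZpExtension ℚ p) (γ : Field.absoluteGaloisGroup ℚ), κ.IsCyclotomic →
        κ.IsTopGenerator γ → IsCyclotomicVariable p γ → ∀ S : W.SelmerDualData κ γ,
        S.IsTorsion ∧ ∃ g : IwasawaAlgebra p, S.charIdeal = Ideal.span {g} ∧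
          iwasawaToPowerSeries p g =
            PowerSeries.C ((u : ℚ_[p])⁻¹) * padicLFunction D.f (unitRoot W p : ℚ_[p])) →
      ∃ (n : ℕ) (_ : NeZero n), Squarefree n ∧ n.primeFactors.card = W.mordellWeilRank ∧
        (∀ ℓ ∈ n.primeFactors, ¬ ℓ ∣ N * p ∧ (ℓ : ZMod p) = 1 ∧
          (W.frobeniusTrace ℓ : ZMod p) = 2) ∧
        ∃ ψ : (ℓ : ℕ) → (ZMod ℓ)ˣ →* Multiplicative (ZMod p),
          (∀ ℓ ∈ n.primeFactors, Function.Surjective (ψ ℓ)) ∧ kuriharaNumber D.f p n ψ ≠ 0)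
    (hMC' : ∀ (W : WeierstrassCurve ℚ) [W.IsElliptic] [W.IsGloballyMinimal] (p : ℕ) [Fact p.Prime]
      (κ : ZpExtension ℚ p) (γ : Field.absoluteGaloisGroup ℚ) {N : ℕ} [NeZero N]
      (f : CuspForm (Gamma0 N) 2),
      5 ≤ p → W.HasGoodReductionAtPrime p → ¬ (p : ℤ) ∣ W.frobeniusTrace p →
      (∀ m : ℕ, W.HasSurjectiveModNGaloisRep (p ^ m : ℕ)) →
      κ.IsCyclotomic → κ.IsTopGenerator γ → IsCyclotomicVariable p γ → IsNewformOf W f →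
      (∃ u : ℚ, ‖(u : ℚ_[p])‖ = 1 ∧ W.realPeriodRat = u * plusPeriod f) →
      ∀ S : W.SelmerDualData κ γ, S.IsTorsion ∧ ∃ g : IwasawaAlgebra p,
        S.charIdeal = Ideal.span {g} ∧
          iwasawaToPowerSeries p g = padicLFunction f (unitRoot W p : ℚ_[p])) :
    Kim2022_kuriharaNumber_certificate := by
  intro W _ _ p _ h5 hord hsurj htors htam hsha N _ D hc hper
  obtain ⟨u, hu1, hu⟩ := hper
  have hgood : W.HasGoodReductionAtPrime p := ((isOrdinaryAt_iff W p).1 hord).1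
  have hap : ¬ (p : ℤ) ∣ W.frobeniusTrace p := ((isOrdinaryAt_iff W p).1 hord).2
  have him : ∀ m : ℕ, W.HasSurjectiveModNGaloisRep (p ^ m : ℕ) :=
    serre_hasSurjectiveModNGaloisRep_pow_holds W p h5 hsurj
  refine hKim W p h5 hord hsurj htors htam hsha D hc u hu1 hu fun κ γ hκ hγ hγ' S => ?_
  obtain ⟨hXtors, hg⟩ :=
    hMC' W p κ γ D.f h5 hgood hap him hκ hγ hγ' D.isNewformOf ⟨u, hu1, hu⟩ S
  exact ⟨hXtors, (exists_span_eq_and_map_eq_C_inv_mul_iff p hu1 _ _).2 hg⟩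

/-! ### The rank-zero instance of the certificate -/

/-- **Rank zero: `[0]⁺_f = L(E,1)/Ω⁺_f` is a `p`-adic unit.** In Mordell–Weil rank `0` the
certificate's `n` has no prime factor, so `n = 1` and its Kurihara number is
`δ̃₁ = \overline{[0]⁺}` (`kuriharaNumber_one`; Kim 2022, §1.4.3: "When `n = 1`, we have
`δ̃_1 = [0]⁺ = L(E,1)/Ω⁺_E`"): under the hypotheses of `Kim2022_kuriharaNumber_certificate` and
`rk_ℤ E(ℚ) = 0`, the reduction of `[0]⁺_f = L(f,1)/Ω⁺_f` mod `p` is non-zero — the numerator of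
the `p`-part of the Birch–Swinnerton-Dyer formula in rank `0` when `Ш[p]`, the Tamagawa numbers
and (by `ρ̄` onto) `E(ℚ)[p]` are prime to `p`. [cite: Kim2022StructureSelmer, Thm. 1.11 (PDF p. 8) and §1.4.3 (p. 7)] -/
theorem Kim2022_kuriharaNumber_certificate.ratPlusSymbol_zero_ne_zero
    (h : Kim2022_kuriharaNumber_certificate) (W : WeierstrassCurve ℚ) [W.IsElliptic]
    [W.IsGloballyMinimal] (p : ℕ) [Fact p.Prime] (h5 : 5 ≤ p) (hord : IsOrdinaryAt W p)
    (hsurj : W.HasSurjectiveModNGaloisRep p)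
    (htors : ∀ P : (W.baseChange ℚ_[p]).toAffine.Point, (p : ℤ) • P = 0 → P = 0)
    (htam : ¬ p ∣ W.tamagawaProduct) (hsha : ∀ x : W.sha, (p : ℤ) • x = 0 → x = 0)
    {N : ℕ} [NeZero N] (D : ModularParametrizationData W N) (hc : ¬ (p : ℤ) ∣ D.maninConstant)
    (hper : ∃ u : ℚ, ‖(u : ℚ_[p])‖ = 1 ∧ W.realPeriodRat = u * plusPeriod D.f)
    (hrk : W.mordellWeilRank = 0) :
    ((ratPlusSymbol D.f 0 : ℚ) : ZMod p) ≠ 0 := by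
  obtain ⟨n, hn, -, hcard, -, ψ, -, hne⟩ := h W p h5 hord hsurj htors htam hsha D hc hper
  rw [hrk, Finset.card_eq_zero, Nat.primeFactors_eq_empty] at hcard
  obtain rfl : n = 1 := hcard.resolve_left hn.out
  rwa [kuriharaNumber_one, ratModP_eq_ratCast] at hne

end Literature.NumberTheory.EllipticCurves

end
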